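/-
Copyright: cell `pub-ymgap` (HUMAN RULING D-0062), Track A of `YM-PLAN.md`, DAG node N20 (= NE7b); R134 acceleration seat
`pub-ymgap-dag-n20-c` (strategy s1, generation 2), module 7.  Released under the licence of the surrounding project.
-/
import Summits.QuantumFields.YangMills.Theorems.BalabanUVNodesN20LCSEvenAllClasses
import Summits.QuantumFields.YangMills.Theorems.BalabanUVNodesN20LCSCoarseSparseness
import Summits.QuantumFields.BalabanUV.T4Continuum.Spine.NE7b.LocalConditionalStability
import Literature.MathematicalPhysics.QuantumFieldTheory.Balaban1983to89.GibbsMeasureWilsonDictionary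
import Literature.MathematicalPhysics.QuantumFieldTheory.Balaban1983to89.Node00.DatumAvLayer
import HarnessLib

/-!
# YM-DAG node N20 (= NE7b), strategy s1, module 7: «LCS-j» AT THE RECORD, LEVEL 0 — (LS) rung 0 for the cell's Gibbs measure on
# Bałaban's `T^{(0)}`, level-0 large-field sparseness (print's `p₀`-extraction) in NODE 00's currency, and
# `LocalConditionalStability.LocCondStability` INHABITED at cutoff `1` for NODE 00's term of record `ρ₀ = rhoZeroOfRecord`

Track A of `YM-PLAN.md` (cell `pub-ymgap`, HUMAN RULING D-0062), node **N20** = spine estimate NE7b (`T4WeightBudget.RelWeightBound` — the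
cell `pub-balaban`'s OWN estimate, NOT PRINTED in [Bałaban 1983–89], NOT PROVED).  Seat `pub-ymgap-dag-n20-c` (R134, s1 «the
`LocCondStability` INSTANCE for Bałaban's tower at a pinned 𝐑𝐓 step»), module 7 (module 6: `…Theorems.BalabanUVNodesN20LCSEvenAllClasses`;
modules 1–5 of generation 0).  Kernel theorems only: 0 `def`, 0 `sorry`, standard axioms; COUNT-NEUTRAL; `--supports` the K3 item
`SpineGivenEndpointR11` (stmt-QuantumFields-19676).  Nothing of Bałaban's is asserted: the objects are NODE 00's (`cfgOfRecord`, `rhoZeroOfRecord`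
of `Node00.DatumAvLayer`; `T4GenFunBounds.gibbsMeasure`; `Missing.boltzmann`, `fieldMeasure`), read BY NAME.

WHY (g0's located residual (iii) of `N20-S1-TRIAGE.md` §1, «carrier junction `GaugeConfig 4 (2S+1) G` (rung 0) ↔ `GaugeField (F.P K) 0 (SU N)`
(NODE 00; EVEN side) — NOT in tree»).  The junction IS in the tree BY NAME: `TorusReflectionPositivity` §1 (`toConfig`∕`ofConfig`,
`plaquetteHolonomy_toConfig`, `reTr_mul_card_SU`) and `GibbsMeasureWilsonDictionary.integral_gibbsMeasure_eq_integral_wilsonMeasure` (the cell's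
`gibbsMeasure P β` on `GaugeField P 0 SU(N)` is the push-forward of the host `wilsonMeasure (fundamentalRep (Fin N)) (β∕N)` along `ofConfig`).
THIS FILE composes it with module 6's even-torus rung 0:
* §1 **`localExpMoment_gibbsMeasure`** — ONE `C = C(N) ≥ 0` with `∫ exp(a·β·Σ_{p∈Q}(1 − Re tr U(∂p))) d(gibbsMeasure P β) ≤ exp(C·a·#Q)` for
  every `d = 4` parameter set `P`, every `β ≥ 4N`, `0 ≤ a ≤ 1∕12` and every finite set `Q` of level-0 plaquettes (normalised trace `Re tr∕N`, the
  cell's units: `β` here is Bałaban's `g₀⁻²`); **`expect_exp_plaqSum_le`** (the `Missing.expect` form); **`lcs_boltzmann`** — the same in the history-term currency (`Integrable (M·e^{−βA}) ∏dU` and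
  `∫ M·e^{−βA} ≤ e^{C·a·#Q}·∫ e^{−βA}`); **`integral_plaqEnergy_gibbsMeasure_le_div`** (mean plaquette `≤ C'∕β`);
  **`gibbsMeasure_largeField_le`** — level-0 LARGE FIELDS ARE EXPONENTIALLY SPARSE: `gibbsMeasure P β {∀ p ∈ X, ε ≤ 1 − Re tr U(∂p)} ≤
  exp(−((βε − C)∕12)·#X)` — print's first-step mechanism [Balaban1989LargeFieldI] (0.1) p. 175 «The term in the Wilson action, corresponding
  to the plaquette p, gives the estimate exp(−g₀⁻²[1 − Re tr U(∂p)]) ≤ exp(−p₀(g₀))» for WHOLE SETS at once, with the volume factor `e^{C∕12}`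
  per plaquette made explicit (the cost–volume inequality of `LocalConditionalStability.sum_admS_integral_le_of_LCS` at level 0 reads
  `βε > C`); **`indicator_largeField_le`** (half (i), `PointwiseExtraction`'s Chebyshev split, verbatim at level 0).
* §2 **`lcs_rhoZeroOfRecord`** and **`locCondStability_one_of_record`** — for NODE 00's initial density `ρ₀ = e^{−E}e^{−g₀⁻²A}` on
  `cfgOfRecord F N K 0` (`g₀⁻² ≥ 4N`): `LocCondStability T S 1 μ ρ₀ M b` HOLDS for EVERY history tower `T` over NODE 00's configuration spaces,
  every pattern `S`, every level-measure family with `μ 0 = ∏dU`, and every carrier family whose level-0 member is a plaquette-energy carrier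
  `exp(a·g₀⁻²·Σ_{p∈Q(g)}(1 − Re tr U(∂p)))`, `0 ≤ a ≤ 1∕12`, with exponents `b 0 g ≥ C·a·#Q(g)` — at cutoff `1` the named `Prop` speaks of
  `Tower.eterm ρ₀ 0 g = ρ₀` alone, and there the (α)-instance's first rung is a theorem, `β`-uniform.

HONEST FRAMING.  Level 0 only (the first 𝐑𝐓 step's OWN state `ρ₀·∏dU`): the carriers of the later steps (`M j g`, `j ≥ 1`, against the pinned
fine densities of module 3) need residual (i) (domination letter for `avOfRecord`) or (ii) (restricted-measure chessboard), and levels `≥ 2` the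
(A1c) 𝐑-quotients (iv) — UNCHANGED.  NE7b NOT PRINTED ∕ NOT PROVED; (α)-instance 0∕1 (its level-0 rung typed here is not the instance);
N20 NOT discharged; typed 28∕28, discharged count untouched; one finite four-torus at fixed `ε` — NOT ℝ⁴, NOT infinite volume, NOT OS, NOT
a mass gap, NOT Clay.
-/

set_option autoImplicit false

noncomputable section

namespace Summit.QuantumFields.YangMills.BalabanUVNodes.N20LCSAtRecordLevelZero

open MeasureTheory
open Literature.MathematicalPhysics.QuantumFieldTheory
open Summit.QuantumFields.YangMills.BalabanUVNodes.N20LCSEvenAllClasses (localExpMoment_even integral_plaqEnergy_le_div_even)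

/-! ## §1 AT THE RECORD's level-0 torus: Bałaban's `T^{(0)}` of a `d = 4` parameter set `P`, gauge group `SU(N)`, the Gibbs measure
`gibbsMeasure P β = Z⁻¹e^{−βA(U)}∏dU(b)` of the cell (= the push-forward of `wilsonMeasure (fundamentalRep (Fin N)) (β∕N)`,
`GibbsMeasureWilsonDictionary`) -/

section Record

open Literature.MathematicalPhysics.QuantumFieldTheory.Balaban1983to89
open Literature.MathematicalPhysics.QuantumLattice (fundamentalRep continuous_fundamentalRep fundamentalRep_injective
  fundamentalRep_mem_unitaryGroup)
open Summit.QuantumFields.YangMills.BalabanUVNodes.N20LCSCoarseSparseness (measureReal_forall_le_le_of_expMoment)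

variable {N : ℕ} [NeZero N]

/-- **THE DICTIONARY FOR ONE PLAQUETTE ENERGY**: read through `ofConfig`, the host energy `N − Re tr(V_p)` of the fundamental representation
is `N·(1 − Re tr V(∂p)∕N)` = `N` times the cell's normalised plaquette energy (`plaquetteHolonomy_toConfig`, `reTr_mul_card_SU`). [folklore] -/
theorem plaqEnergy_ofConfig (P : Params) (V : GaugeConfig P.d (P.sitesPerDir 0) (Matrix.specialUnitaryGroup (Fin N) ℂ))
    (p : Plaq P 0) :
    (N : ℝ) - WilsonRP.plaqRe (fundamentalRep (Fin N)) V (plaqEquiv 0 p) =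
      N * (1 - reTr (GaugeField.plaqHol (ofConfig V) p)) := by
  have h1 := plaquetteHolonomy_toConfig (ofConfig (P := P) (j := 0) V) p
  have h2 := reTr_mul_card_SU (N := N) (GaugeField.plaqHol (ofConfig (P := P) (j := 0) V) p)
  rw [toConfig_ofConfig] at h1
  show (N : ℝ) - ((fundamentalRep (Fin N)) (plaquetteHolonomy V p.src p.μ p.ν)).trace.re = _
  rw [h1, ← h2]
  ring

/-- The cell's plaquette-energy carrier `U ↦ exp(t·Σ_{p∈Q} (1 − Re tr U(∂p)))` is measurable. [folklore] -/
theorem measurable_exp_plaqSum (P : Params) (t : ℝ) (Q : Finset (Plaq P 0)) :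
    Measurable fun U : GaugeField P 0 (Matrix.specialUnitaryGroup (Fin N) ℂ) =>
      Real.exp (t * ∑ p ∈ Q, (1 - reTr (GaugeField.plaqHol U p))) :=
  Real.measurable_exp.comp ((Finset.measurable_sum Q fun p _ =>
    measurable_const.sub (RegularGaugeGroup.measurable_reTr.comp (Missing.measurable_plaqHol p))).const_mul t)

/-- The carrier is bounded: `|exp(t·Σ_{p∈Q} (1 − Re tr U(∂p)))| ≤ exp(|t|·2·#Q)` (`0 ≤ 1 − Re tr ≤ 2`). [folklore] -/
theorem abs_exp_plaqSum_le (P : Params) (t : ℝ) (Q : Finset (Plaq P 0))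
    (U : GaugeField P 0 (Matrix.specialUnitaryGroup (Fin N) ℂ)) :
    |Real.exp (t * ∑ p ∈ Q, (1 - reTr (GaugeField.plaqHol U p)))| ≤ Real.exp (|t| * (2 * Q.card)) := by
  rw [Real.abs_exp]
  refine Real.exp_le_exp.2 ((le_abs_self _).trans ?_)
  rw [abs_mul]
  refine mul_le_mul_of_nonneg_left ?_ (abs_nonneg t)
  have h0 : ∀ p ∈ Q, 0 ≤ 1 - reTr (GaugeField.plaqHol U p) := fun p _ =>
    (RegularGaugeGroup.one_sub_reTr_mem_Icc _).1
  rw [abs_of_nonneg (Finset.sum_nonneg h0)]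
  calc ∑ p ∈ Q, (1 - reTr (GaugeField.plaqHol U p)) ≤ ∑ _p ∈ Q, (2 : ℝ) :=
        Finset.sum_le_sum fun p _ => (RegularGaugeGroup.one_sub_reTr_mem_Icc _).2
    _ = 2 * Q.card := by rw [Finset.sum_const, nsmul_eq_mul]; ring

/-- **(LS) RUNG 0 AT THE RECORD's LEVEL-0 TORUS.**  There is `C = C(N) ≥ 0` such that for every `d = 4` parameter set `P` (side
`2·L^{m+K}`, even), every `β ≥ 4N`, every `0 ≤ a ≤ 1∕12` and every finite set `Q` of level-0 plaquettes:
`∫ exp(a·β·Σ_{p∈Q} (1 − Re tr U(∂p))) d(gibbsMeasure P β) ≤ exp(C·a·#Q)` — the plaquette energies of the cell's lattice Yang–Mills measure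
`Z⁻¹e^{−βA}∏dU` on `SU(N)` have LOCAL exponential moments at the natural scale `1∕β`, uniformly in `β ≥ 4N` and in the volume
(`localExpMoment_even` through `GibbsMeasureWilsonDictionary`, `β ↦ β∕N`). [folklore] -/
theorem localExpMoment_gibbsMeasure (N : ℕ) [NeZero N] :
    ∃ C : ℝ, 0 ≤ C ∧ ∀ (P : Params), P.d = 4 → ∀ (β : ℝ), 4 * N ≤ β → ∀ (a : ℝ), 0 ≤ a → a ≤ 1 / 12 →
      ∀ (Q : Finset (Plaq P 0)),
        ∫ U, Real.exp (a * β * ∑ p ∈ Q, (1 - reTr (GaugeField.plaqHol U p)))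
            ∂(T4GenFunBounds.gibbsMeasure P β : Measure (GaugeField P 0 (Matrix.specialUnitaryGroup (Fin N) ℂ))) ≤
          Real.exp (C * a * Q.card) := by
  obtain ⟨C, hC0, hC⟩ := localExpMoment_even (G := Matrix.specialUnitaryGroup (Fin N) ℂ)
    (⟨N, fundamentalRep (Fin N), continuous_fundamentalRep (Fin N),
      fundamentalRep_injective (Fin N), fundamentalRep_mem_unitaryGroup⟩ : LatticeRep (Matrix.specialUnitaryGroup (Fin N) ℂ))
  refine ⟨C, hC0, fun P hd β hβ a ha0 ha Q => ?_⟩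
  obtain ⟨d, L, m, K, hd1, hL⟩ := P
  simp only at hd
  subst hd
  have hNpos : (0 : ℝ) < N := Nat.cast_pos.mpr (Nat.pos_of_ne_zero (NeZero.ne N))
  have hβN : 4 ≤ β / N := by rwa [le_div_iff₀ hNpos]
  have hβ0 : 0 ≤ β := le_trans (by positivity) hβ
  rw [GibbsMeasureWilsonDictionary.integral_gibbsMeasure_eq_integral_wilsonMeasure _ hβ0]
  have hEven := even_sitesPerDir ⟨4, L, m, K, hd1, hL⟩ 0
  have h := hC (Params.sitesPerDir ⟨4, L, m, K, hd1, hL⟩ 0) hEven (β / N) hβN a ha0 ha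
    (Q.map (plaqEquiv (P := ⟨4, L, m, K, hd1, hL⟩) 0).toEmbedding)
  rw [Finset.card_map] at h
  dsimp only at h
  refine le_trans (le_of_eq (integral_congr_ae (ae_of_all _ fun V => ?_))) h
  simp only [Finset.sum_map, Equiv.coe_toEmbedding, plaqEnergy_ofConfig ⟨4, L, m, K, hd1, hL⟩ V, ← Finset.mul_sum]
  congr 1
  field_simp

/-- The same bound for the cell's expectation functional `Missing.expect P β` (`= ∫ · d(gibbsMeasure P β)`,
`T4GenFunBounds.integral_gibbsMeasure_eq_expect`): `⟨exp(a·β·Σ_{p∈Q}(1 − Re tr U(∂p)))⟩_{P,β} ≤ exp(C·a·#Q)`. [folklore] -/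
theorem expect_exp_plaqSum_le (N : ℕ) [NeZero N] :
    ∃ C : ℝ, 0 ≤ C ∧ ∀ (P : Params), P.d = 4 → ∀ (β : ℝ), 4 * N ≤ β → ∀ (a : ℝ), 0 ≤ a → a ≤ 1 / 12 →
      ∀ (Q : Finset (Plaq P 0)),
        Missing.expect (G := Matrix.specialUnitaryGroup (Fin N) ℂ) P β
            (fun U => Real.exp (a * β * ∑ p ∈ Q, (1 - reTr (GaugeField.plaqHol U p)))) ≤ Real.exp (C * a * Q.card) := by
  obtain ⟨C, hC0, hC⟩ := localExpMoment_gibbsMeasure N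
  refine ⟨C, hC0, fun P hd β hβ a ha0 ha Q => ?_⟩
  have hNpos : (0 : ℝ) < N := Nat.cast_pos.mpr (Nat.pos_of_ne_zero (NeZero.ne N))
  have hβ0 : 0 ≤ β := le_trans (by positivity) hβ
  rw [← T4GenFunBounds.integral_gibbsMeasure_eq_expect P hβ0]
  exact hC P hd β hβ a ha0 ha Q

/-- **THE SAME IN THE HISTORY-TERM CURRENCY** (un-normalised: the level-0 term `ρ₀ = e^{−βA}` against the product Haar measure, both conjuncts
of `LocCondStability` at level `0`): with the constant `C` of `localExpMoment_gibbsMeasure`, the carrier `M = exp(a·β·Σ_{p∈Q}(1 − Re tr U(∂p)))`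
satisfies `Integrable (M·e^{−βA}) ∏dU` and `∫ M·e^{−βA} ∏dU ≤ exp(C·a·#Q)·∫ e^{−βA} ∏dU`. [folklore] -/
theorem lcs_boltzmann (N : ℕ) [NeZero N] :
    ∃ C : ℝ, 0 ≤ C ∧ ∀ (P : Params), P.d = 4 → ∀ (β : ℝ), 4 * N ≤ β → ∀ (a : ℝ), 0 ≤ a → a ≤ 1 / 12 →
      ∀ (Q : Finset (Plaq P 0)),
        Integrable (fun U : GaugeField P 0 (Matrix.specialUnitaryGroup (Fin N) ℂ) =>
            Real.exp (a * β * ∑ p ∈ Q, (1 - reTr (GaugeField.plaqHol U p))) * Missing.boltzmann P β U)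
          (fieldMeasure P 0 (Matrix.specialUnitaryGroup (Fin N) ℂ)) ∧
        ∫ U, Real.exp (a * β * ∑ p ∈ Q, (1 - reTr (GaugeField.plaqHol U p))) * Missing.boltzmann P β U
            ∂(fieldMeasure P 0 (Matrix.specialUnitaryGroup (Fin N) ℂ)) ≤
          Real.exp (C * a * Q.card) *
            ∫ U, Missing.boltzmann P β U ∂(fieldMeasure P 0 (Matrix.specialUnitaryGroup (Fin N) ℂ)) := by
  obtain ⟨C, hC0, hC⟩ := localExpMoment_gibbsMeasure N
  refine ⟨C, hC0, fun P hd β hβ a ha0 ha Q => ?_⟩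
  have hNpos : (0 : ℝ) < N := Nat.cast_pos.mpr (Nat.pos_of_ne_zero (NeZero.ne N))
  have hβ0 : 0 ≤ β := le_trans (by positivity) hβ
  refine ⟨Missing.integrable_mul_boltzmann RegularGaugeGroup.measurable_reTr hβ0 (measurable_exp_plaqSum P (a * β) Q)
    (abs_exp_plaqSum_le P (a * β) Q), ?_⟩
  have h := hC P hd β hβ a ha0 ha Q
  rw [T4GenFunBounds.integral_gibbsMeasure P hβ0, div_le_iff₀ (Missing.partitionFn_pos' P hβ0)] at h
  exact h

/-- **THE MEAN PLAQUETTE ENERGY AT THE RECORD IS `O(1∕β)`**: there is `C' = C'(N) ≥ 0` with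
`∫ (1 − Re tr U(∂p)) d(gibbsMeasure P β) ≤ C'∕β` for every `d = 4` parameter set `P`, every `β ≥ 4N` and every level-0 plaquette `p`
(`integral_plaqEnergy_le_div_even` through the dictionary: `(1∕N)·C'∕(β∕N) = C'∕β`). [folklore] -/
theorem integral_plaqEnergy_gibbsMeasure_le_div (N : ℕ) [NeZero N] :
    ∃ C' : ℝ, 0 ≤ C' ∧ ∀ (P : Params), P.d = 4 → ∀ (β : ℝ), 4 * N ≤ β → ∀ (p : Plaq P 0),
      ∫ U, (1 - reTr (GaugeField.plaqHol U p))
          ∂(T4GenFunBounds.gibbsMeasure P β : Measure (GaugeField P 0 (Matrix.specialUnitaryGroup (Fin N) ℂ))) ≤ C' / β := by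
  obtain ⟨C', hC0, hC⟩ := integral_plaqEnergy_le_div_even (G := Matrix.specialUnitaryGroup (Fin N) ℂ)
    (⟨N, fundamentalRep (Fin N), continuous_fundamentalRep (Fin N),
      fundamentalRep_injective (Fin N), fundamentalRep_mem_unitaryGroup⟩ : LatticeRep (Matrix.specialUnitaryGroup (Fin N) ℂ))
  refine ⟨C', hC0, fun P hd β hβ p => ?_⟩
  obtain ⟨d, L, m, K, hd1, hL⟩ := P
  simp only at hd
  subst hd
  have hNpos : (0 : ℝ) < N := Nat.cast_pos.mpr (Nat.pos_of_ne_zero (NeZero.ne N))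
  have hβN : 4 ≤ β / N := by rwa [le_div_iff₀ hNpos]
  have hβ0 : 0 ≤ β := le_trans (by positivity) hβ
  rw [GibbsMeasureWilsonDictionary.integral_gibbsMeasure_eq_integral_wilsonMeasure _ hβ0]
  have hEven := even_sitesPerDir ⟨4, L, m, K, hd1, hL⟩ 0
  have h := hC (Params.sitesPerDir ⟨4, L, m, K, hd1, hL⟩ 0) hEven (β / N) hβN (plaqEquiv (P := ⟨4, L, m, K, hd1, hL⟩) 0 p)
  have hid : ∀ V : GaugeConfig 4 (Params.sitesPerDir ⟨4, L, m, K, hd1, hL⟩ 0) (Matrix.specialUnitaryGroup (Fin N) ℂ),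
      (1 - reTr (GaugeField.plaqHol (ofConfig (P := ⟨4, L, m, K, hd1, hL⟩) V) p)) =
        (N : ℝ)⁻¹ * ((N : ℝ) - WilsonRP.plaqRe (fundamentalRep (Fin N)) V (plaqEquiv 0 p)) := by
    intro V
    rw [plaqEnergy_ofConfig ⟨4, L, m, K, hd1, hL⟩ V p, ← mul_assoc, inv_mul_cancel₀ hNpos.ne', one_mul]
  simp_rw [hid]
  rw [integral_const_mul]
  dsimp only at h
  calc (N : ℝ)⁻¹ * ∫ V, ((N : ℝ) - WilsonRP.plaqRe (fundamentalRep (Fin N)) V (plaqEquiv 0 p))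
        ∂(wilsonMeasure (fundamentalRep (Fin N)) (β / N)) ≤ (N : ℝ)⁻¹ * (C' / (β / N)) :=
        mul_le_mul_of_nonneg_left h (inv_nonneg.2 hNpos.le)
    _ = C' / β := by field_simp

/-- **LEVEL-0 LARGE FIELDS ARE EXPONENTIALLY SPARSE AT THE RECORD** (the Peierls consequence = print's `p₀`-extraction at the first step,
[Balaban1989LargeFieldI] (0.1) p. 175 «The term in the Wilson action, corresponding to the plaquette p, gives the estimate
exp(−g₀⁻²[1 − Re tr U(∂p)]) ≤ exp(−p₀(g₀))», in NODE 00's currency and for WHOLE SETS of plaquettes at once): with the constant `C` of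
`localExpMoment_gibbsMeasure`, for every `d = 4` parameter set `P`, every `β ≥ 4N`, every threshold `ε` and every finite set `X` of level-0
plaquettes, `gibbsMeasure P β {U | ∀ p ∈ X, ε ≤ 1 − Re tr U(∂p)} ≤ exp(−((β·ε − C)∕12)·#X)` (Chebyshev at `a = 1∕12`). [folklore] -/
theorem gibbsMeasure_largeField_le (N : ℕ) [NeZero N] :
    ∃ C : ℝ, 0 ≤ C ∧ ∀ (P : Params), P.d = 4 → ∀ (β : ℝ), 4 * N ≤ β → ∀ (ε : ℝ) (X : Finset (Plaq P 0)),
      (T4GenFunBounds.gibbsMeasure P β : Measure (GaugeField P 0 (Matrix.specialUnitaryGroup (Fin N) ℂ))).real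
          {U | ∀ p ∈ X, ε ≤ 1 - reTr (GaugeField.plaqHol U p)} ≤
        Real.exp (-((β * ε - C) / 12 * X.card)) := by
  obtain ⟨C, hC0, hC⟩ := localExpMoment_gibbsMeasure N
  refine ⟨C, hC0, fun P hd β hβ ε X => ?_⟩
  have hNpos : (0 : ℝ) < N := Nat.cast_pos.mpr (Nat.pos_of_ne_zero (NeZero.ne N))
  have hβ0 : 0 ≤ β := le_trans (by positivity) hβ
  haveI := T4GenFunBounds.isProbabilityMeasure_gibbsMeasure (G := Matrix.specialUnitaryGroup (Fin N) ℂ) P hβ0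
  set μ : Measure (GaugeField P 0 (Matrix.specialUnitaryGroup (Fin N) ℂ)) := T4GenFunBounds.gibbsMeasure P β with hμ
  have hint : Integrable (fun U : GaugeField P 0 (Matrix.specialUnitaryGroup (Fin N) ℂ) =>
      Real.exp (1 / 12 * β * ∑ p ∈ X, (1 - reTr (GaugeField.plaqHol U p)))) μ :=
    Integrable.of_bound (measurable_exp_plaqSum P (1 / 12 * β) X).aestronglyMeasurable _
      (ae_of_all _ fun U => by rw [Real.norm_eq_abs]; exact abs_exp_plaqSum_le P (1 / 12 * β) X U)
  have h1 := measureReal_forall_le_le_of_expMoment μ X (fun p U => 1 - reTr (GaugeField.plaqHol U p)) (ε := ε)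
    (δ := 1 / 12) (β := β) (by norm_num) hβ0 hint
  have h2 := hC P hd β hβ (1 / 12) (by norm_num) le_rfl X
  refine h1.trans ?_
  calc (∫ U, Real.exp (1 / 12 * β * ∑ p ∈ X, (1 - reTr (GaugeField.plaqHol U p))) ∂μ) *
        Real.exp (-(1 / 12 * β * ε * X.card))
      ≤ Real.exp (C * (1 / 12) * X.card) * Real.exp (-(1 / 12 * β * ε * X.card)) :=
        mul_le_mul_of_nonneg_right h2 (Real.exp_pos _).le
    _ = Real.exp (-((β * ε - C) / 12 * X.card)) := by
        rw [← Real.exp_add]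
        ring_nf

/-- **POINTWISE EXTRACTION AT LEVEL 0** (half (i) of «LCS-j» in NODE 00's currency, print's mechanism verbatim): the characteristic function
of «every plaquette of `X` is large» is at most `exp(−a·β·ε·#X)` times the carrier `exp(a·β·Σ_{p∈X}(1 − Re tr U(∂p)))`, `a ≥ 0`, `β ≥ 0`
(`LocalConditionalStability.chebyshev_extraction_single`). [folklore] -/
theorem indicator_largeField_le (P : Params) {a β : ℝ} (ha : 0 ≤ a) (hβ : 0 ≤ β) (ε : ℝ) (X : Finset (Plaq P 0))
    (U : GaugeField P 0 (Matrix.specialUnitaryGroup (Fin N) ℂ)) :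
    Set.indicator {U | ∀ p ∈ X, ε ≤ 1 - reTr (GaugeField.plaqHol U p)} (fun _ => (1 : ℝ)) U ≤
      Real.exp (-(a * β * (ε * X.card))) * Real.exp (a * β * ∑ p ∈ X, (1 - reTr (GaugeField.plaqHol U p))) := by
  classical
  refine Summit.QuantumFields.BalabanUV.T4Continuum.NE7b.LocalConditionalStability.chebyshev_extraction_single
    (Set.indicator {U | ∀ p ∈ X, ε ≤ 1 - reTr (GaugeField.plaqHol U p)} fun _ => (1 : ℝ))
    (fun U => ∑ p ∈ X, (1 - reTr (GaugeField.plaqHol U p))) (mul_nonneg ha hβ) (fun U => ?_) (fun U hU => ?_) U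
  · exact Set.indicator_le_self' (fun _ _ => zero_le_one) U
  · have hmem : U ∈ {U | ∀ p ∈ X, ε ≤ 1 - reTr (GaugeField.plaqHol U p)} := by
      by_contra hn
      exact hU (Set.indicator_of_notMem hn _)
    calc ε * X.card = ∑ _p ∈ X, ε := by rw [Finset.sum_const, nsmul_eq_mul, mul_comm]
      _ ≤ ∑ p ∈ X, (1 - reTr (GaugeField.plaqHol U p)) := Finset.sum_le_sum fun p hp => hmem p hp

end Record

/-! ## §2 NODE 00's level-0 carriers of record: `LocCondStability` INHABITED at cutoff `1` for the term `ρ₀ = rhoZeroOfRecord` -/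

section NodeZero

open Literature.MathematicalPhysics.QuantumFieldTheory.Balaban1983to89
open Literature.MathematicalPhysics.QuantumFieldTheory.Balaban1983to89.T4Continuum
open Summit.QuantumFields.BalabanUV.T4Continuum.B16HistoryIndexedRepr (GoodClass)
open Summit.QuantumFields.BalabanUV.T4Continuum.B16HistoryReprChain (Tower)
open Summit.QuantumFields.BalabanUV.T4Continuum.NE7b.PrefixExtraction (admS)
open Summit.QuantumFields.BalabanUV.T4Continuum.NE7b.LocalConditionalStability (LocCondStability)

/-- `(F.P K).d = 4` (`rfl`). [folklore] -/
theorem d_eq_four (F : T4Family) (K : ℕ) : (F.P K).d = 4 := rfl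

/-- **LCS AT LEVEL 0 FOR THE TERM OF RECORD.**  There is `C = C(N) ≥ 0` such that on every torus `F.P K` of the family, for every bare
coupling `g₀` with `g₀⁻² ≥ 4N`, every normalisation `E`, every `0 ≤ a ≤ 1∕12` and every finite set `Q` of level-0 plaquettes, the carrier
`M = exp(a·g₀⁻²·Σ_{p∈Q}(1 − Re tr U(∂p)))` against NODE 00's initial density `ρ₀ = e^{−E}e^{−g₀⁻²A}` (`Node00.rhoZeroOfRecord`) and the
product Haar measure satisfies `Integrable (M·ρ₀)` and `∫ M·ρ₀ ≤ exp(C·a·#Q)·∫ ρ₀`. [folklore] -/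
theorem lcs_rhoZeroOfRecord (F : T4Family) (N : ℕ) [NeZero N] :
    ∃ C : ℝ, 0 ≤ C ∧ ∀ (K : ℕ) (g₀ E : ℝ), 4 * N ≤ g₀⁻¹ ^ 2 → ∀ (a : ℝ), 0 ≤ a → a ≤ 1 / 12 →
      ∀ (Q : Finset (Plaq (F.P K) 0)),
        Integrable (fun U : Node00.cfgOfRecord F N K 0 =>
            Real.exp (a * g₀⁻¹ ^ 2 * ∑ p ∈ Q, (1 - reTr (GaugeField.plaqHol U p))) * Node00.rhoZeroOfRecord F N K g₀ E U)
          (fieldMeasure (F.P K) 0 (Node00.SU N)) ∧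
        ∫ U, Real.exp (a * g₀⁻¹ ^ 2 * ∑ p ∈ Q, (1 - reTr (GaugeField.plaqHol U p))) * Node00.rhoZeroOfRecord F N K g₀ E U
            ∂(fieldMeasure (F.P K) 0 (Node00.SU N)) ≤
          Real.exp (C * a * Q.card) * ∫ U, Node00.rhoZeroOfRecord F N K g₀ E U ∂(fieldMeasure (F.P K) 0 (Node00.SU N)) := by
  obtain ⟨C, hC0, hC⟩ := lcs_boltzmann N
  refine ⟨C, hC0, fun K g₀ E hg a ha0 ha Q => ?_⟩
  obtain ⟨hint, hle⟩ := hC (F.P K) (d_eq_four F K) (g₀⁻¹ ^ 2) hg a ha0 ha Q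
  have hρ : ∀ U : Node00.cfgOfRecord F N K 0,
      Node00.rhoZeroOfRecord F N K g₀ E U = Real.exp (-E) * Missing.boltzmann (F.P K) (g₀⁻¹ ^ 2) U := fun U => rfl
  simp_rw [hρ, mul_left_comm _ (Real.exp (-E)), integral_const_mul]
  refine ⟨hint.const_mul _, ?_⟩
  rw [mul_left_comm]
  exact mul_le_mul_of_nonneg_left hle (Real.exp_pos _).le

/-- **`LocCondStability` INHABITED AT CUTOFF `1` FOR BAŁABAN's LEVEL-0 TERM OF RECORD** (the first rung of the (α)-instance, by name).  For ANY
history tower `T` over NODE 00's configuration spaces `cfgOfRecord F N K ·`, any pattern `S`, any level measures `μ` with `μ 0` the product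
Haar measure, and NODE 00's initial density `ρ₀ = rhoZeroOfRecord F N K g₀ E` (`g₀⁻² ≥ 4N`): a carrier family whose level-0 member is the
plaquette-energy carrier `exp(a·g₀⁻²·Σ_{p∈Q(g)}(1 − Re tr U(∂p)))` (`0 ≤ a ≤ 1∕12`) with exponents `b 0 g ≥ C·a·#Q(g)` satisfies
`LocCondStability T S 1 μ ρ₀ M b` — at cutoff `1` the named `Prop` speaks of the level-0 term `eterm ρ₀ 0 g = ρ₀` alone, and there it HOLDS,
uniformly in the running coupling (`C = C(N)`); levels `j ≥ 1` are the located residuals (i)∕(ii)∕(iv) of modules 1–3, untouched. [folklore] -/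
theorem locCondStability_one_of_record (F : T4Family) (N : ℕ) [NeZero N] :
    ∃ C : ℝ, 0 ≤ C ∧ ∀ (K : ℕ) (g₀ E : ℝ), 4 * N ≤ g₀⁻¹ ^ 2 → ∀ (a : ℝ), 0 ≤ a → a ≤ 1 / 12 →
      ∀ {Pat : Type} [DecidableEq Pat] {𝒢 : (j : ℕ) → GoodClass (Node00.cfgOfRecord F N K j)}
        (T : Tower Pat (fun j => Node00.cfgOfRecord F N K j) 𝒢) (S : (j : ℕ) → (Fin j → Pat) → Finset Pat)
        (μ : (j : ℕ) → Measure (Node00.cfgOfRecord F N K j))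
        (M : (j : ℕ) → (Fin j → Pat) → Node00.cfgOfRecord F N K j → ℝ) (b : (j : ℕ) → (Fin j → Pat) → ℝ)
        (Q : (Fin 0 → Pat) → Finset (Plaq (F.P K) 0)),
        μ 0 = fieldMeasure (F.P K) 0 (Node00.SU N) →
        (∀ g U, M 0 g U = Real.exp (a * g₀⁻¹ ^ 2 * ∑ p ∈ Q g, (1 - reTr (GaugeField.plaqHol U p)))) →
        (∀ g, C * a * (Q g).card ≤ b 0 g) →
        LocCondStability T S 1 μ (Node00.rhoZeroOfRecord F N K g₀ E) M b := by
  obtain ⟨C, hC0, hC⟩ := lcs_rhoZeroOfRecord F N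
  refine ⟨C, hC0, fun K g₀ E hg a ha0 ha Pat _ 𝒢 T S μ M b Q hμ hM hb => ?_⟩
  intro j g hj _
  obtain rfl : j = 0 := Nat.lt_one_iff.mp hj
  have hMg : M 0 g = fun U => Real.exp (a * g₀⁻¹ ^ 2 * ∑ p ∈ Q g, (1 - reTr (GaugeField.plaqHol U p))) := funext (hM g)
  show Integrable (fun y => M 0 g y * Node00.rhoZeroOfRecord F N K g₀ E y) (μ 0) ∧
    ∫ y, M 0 g y * Node00.rhoZeroOfRecord F N K g₀ E y ∂μ 0 ≤
      Real.exp (b 0 g) * ∫ y, Node00.rhoZeroOfRecord F N K g₀ E y ∂μ 0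
  rw [hMg, hμ]
  obtain ⟨hint, hle⟩ := hC K g₀ E hg a ha0 ha (Q g)
  refine ⟨hint, hle.trans (mul_le_mul_of_nonneg_right (Real.exp_le_exp.2 (hb g))
    (integral_nonneg fun U => (Node00.rhoZeroOfRecord_pos F N K g₀ E U).le))⟩

end NodeZero

end Summit.QuantumFields.YangMills.BalabanUVNodes.N20LCSAtRecordLevelZero

end
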